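import Summits.SmoothPoincare4.SmoothPoincare4.Theses.SymplecticOrigami
import Summits.SmoothPoincare4.SmoothPoincare4.Theorems.NoGenusTwoDoor.Negative.NoncompactDoor
import Literature.Geometry.Kaehler.ManifoldFormsPullback
import Literature.Geometry.Symplectic.SteinDomain
import Literature.Topology.FourManifolds.Cobordism
import Literature.AlgebraicTopology.SingularHomology.SingularChains
import Literature.AlgebraicTopology.SingularHomology.PoincareDuality

/-!
# Line `liouville-genus-two-complement` — skeleton for crux `SymplecticOrigami.NoGenusTwoDoor`

(item stmt-SmoothPoincare4-7842, route `route-SmoothPoincare4-SymplecticOrigami`, rank 2;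
idea card `Cruxes/NoGenusTwoDoor/Ideas/liouville-genus-two-complement.md` — hub of the FILLING
cluster merged by the triage panel with `canonical-cap-filling` and `semidefinite-filling-door`;
triage r1-1/2/3: pass ×3; standing disprover `Cruxes/NoGenusTwoDoor/Disproof.lean` v3: no kill.)

Crux (fixed, never restated): no closed connected symplectic 4-manifold `(N, s)` — `s` a smooth,
closed, pointwise non-degenerate `MForm (𝓡 4) N ℝ 2` on a compact `ℝ⁴`-charted `C^∞` manifold — has
`(rank H₁(N; ℤ), rank H₂(N; ℤ)) = (2, 1)` (a "door").

## The line: Taubes curve → EXACT complement → small-filling rigidity of ONE contact manifold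

The lever is the COMPLEMENT of the canonical curve.  A door `N` has `b⁺ = 1`, `b⁻ = 0`, `K² = 1`,
`K ≡ h` (`h² = +1` the generator of `H₂/torsion`), and Seiberg–Witten theory at `b⁺ = 1` is
chamber-free on it (the Li–Liu wall-crossing number is a multiple of the cup product `H¹ ⊗ H¹ → H²`,
which is torsion when `b₂ = 1` — `DoorCupOneOneVanishes`, PROVED in the triage folder), so Taubes'
`SW ⇒ Gr` gives an embedded CONNECTED symplectic genus-2 curve `B` in the class `K`, `B·B = 1`,
`B·h = ±1` (`stub_canonicalCurve`).  Because `b₂(N) = 1` and `[B] ≠ 0`, the symplectic class is a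
POSITIVE multiple of `PD[B]`, so `s` is EXACT on `N ∖ B` and (McLean / Diogo–Lisi divisor-complement
lemma: Diogo–Lisi, arXiv:1804.08014 Lemma 1.2 = Opshtein Lemma 2.1 / Giroux Prop. 5; + Gray)
`W := N ∖ ν(B)` is a LIOUVILLE DOMAIN whose convex boundary is the Euler-number-`(−1)`
Boothby–Wang circle bundle over `Σ₂`, i.e. — as a contact manifold — the LINK of the weighted
homogeneous surface singularity `x² + y⁵ + z¹⁰ = 0` (weights `(5, 2, 1)`, degree `10`: free
`S¹`-action on the link, quotient the smooth genus-2 curve `{x² + y⁵ + z¹⁰ = 0} ⊂ ℙ(5, 2, 1)`,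
Seifert Euler number `−10/(5·2·1) = −1`; identification checked by all three triagers) with its
canonical contact form `λ₀|_link`, `λ₀ = ½ Σ (xⱼ dyⱼ − yⱼ dxⱼ)`; and the complement's topology is
forced: `b₁(W) = 2`, `χ(W) = 1`, `b₃(W) = 2 − r ≤ 2`, `b₂(W) = 4 − r`, intersection form
`Q_W ⊗ ℚ ≡ 0`, i.e. `H₂(∂W; ℚ) ↠ H₂(W; ℚ)` (`stub_exactComplement` for the geometry,
`stub_complementTopology` for the numerics = Disproof §9 `complement_bookkeeping`).  What is
left is ONE statement about ONE explicit contact 3-manifold (`stub_smallFillingRigidity`, the HARDEST stub = the card's transfer `C⁺` as sharpened by the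
triage panel and by Disproof §10): the genus-2 link has NO Liouville filling `W` with
`Q_W ⊗ ℚ ≡ 0`, `b₁(W) = 2`, `χ(W) = 1`.  By the capping computation (glue the square-`(+1)` genus-2
cap `D₊₁(Σ₂)`; triage `GenusTwoPinsDoor`, Disproof §4 `filling_numerics`) this statement is
EQUIVALENT to the crux — zero slack — but it lives where filling technology lives: a fixed Seifert
contact manifold with periodic Reeb flow, `c₁(ξ) = 0`, `b₁ = 4`, explicit comparison fillings
sharing the door's cap (`D₋₁(Σ₂)` Stein: `(b₁; χ, b⁻) = (4; −2, 1)`; the disprover's NEW family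
`W_k = ((T² × S²) # k ℂP²bar) ∖ ν(genus-2 square-1 bisection curve)`: `(2; k + 2, k + 1)`, `k ≥ 1`;
rational `(0; k + 5, k + 4)`; Godeaux `(0; 13, 8)`; the Milnor fibre `(0; 37, 28)`), against which
the door's complement is the point `(2; 1, 0)` — the `k = −1` extrapolation of the `W_k` family on
the line `b⁻ = χ − 1`, two steps below everything in print.

Model, typed WITHOUT new definitions: the link is the subset
`𝕃 = {p ∈ ℝ⁶ : ‖p‖ = 1, (p₀ + i p₁)² + (p₂ + i p₃)⁵ + (p₄ + i p₅)¹⁰ = 0}` of `EuclideanSpace ℝ (Fin 6)`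
and `λ₆` the 1-form `p ↦ ½ Σⱼ (p₂ⱼ dq₂ⱼ₊₁ − p₂ⱼ₊₁ dq₂ⱼ)` on `ℝ⁶` (local NOTATIONS, so every registered
stub signature is a term over Mathlib + tree declarations only).  "`∂(W, λ)` is the genus-2 link"
reads: some boundary datum `bW : BoundaryData (𝓡∂ 4) W (𝓡 3)` (the tree's abstract `∂W`) admits a
smooth embedding `e : bW.carrier → ℝ⁶` with `range e = 𝕃` and `e^* λ₆ = f · (incl^* λ)` for a
nowhere-vanishing `f` — written POINTWISE, `λ₆ (e z) (de_z v) = f z · λ (incl z) (d incl_z v)` for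
every tangent vector `v` (this is `MForm.pullback_apply` unfolded; it keeps `:=`-syntax out of the
registered stub signatures) — i.e. a contactomorphism onto `(𝕃, ker λ₀)`; the sign of `f` is
immaterial because complex conjugation of `ℂ³` preserves `𝕃` and maps `λ₀ ↦ −λ₀`.

## Shape (enforced by `#h21_check_skeleton` / `ledger skeleton check`)

Four registered stubs `theorem stub_… := by sorry`, used BY NAME in the sorry-free composition
`NoGenusTwoDoor_of : SymplecticOrigami.NoGenusTwoDoor` (no hypotheses at all: the line consumes no
route item and no named fact as a premise — Taubes, McLean/Diogo–Lisi, Gysin/Lefschetz bookkeeping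
are INSIDE the stubs, where the lead's stub-workers vendor what they need with `--supports`).
The cut follows the toolkits: gauge theory (1) / symplectic geometry (2) / algebraic topology (3) /
contact & filling technology (4); stubs 2 and 3 share one typed interface (`ι : W ↪ N ∖ B` a
codimension-0 embedding and homotopy equivalence, `bW` a boundary datum).

* `stub_canonicalCurve` (XL formally, THEOREM in print): door ⇒ embedded connected symplectic
  genus-2 surface `b : S ↪ N` (`rank H₁(S) = 4`) whose complement has the SAME `H₁`:
  `H₁(N ∖ B; ℤ) → H₁(N; ℤ)` bijective (⟺ `B·h = ±1` ⟺ the meridian bounds ⟺ `B² = 1` with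
  `b₂ = 1`).  = card `semidefinite-filling-door`'s first lemma `door_has_symplectic_genus_two_surface`
  (SketchIdeator3) PLUS the `H₁` clause, which Taubes' theorem gives for free (`[B] = K ≡ ±h`) and
  which spares the next stub Liu's rational/ruled classification (needed otherwise to exclude the
  arithmetic ghost `[B] = ±2h`, `B² = 4`, `K·B = −2` allowed by adjunction alone).
* `stub_exactComplement` (L; symplectic neighbourhood theorem + exactness from `b₂ = 1` +
  McLean/Diogo–Lisi Liouville structure on a divisor complement + Gray stability for Boothby–Wang
  forms `gθ + π^*β` + uniqueness of the Euler-number-`(−1)` Boothby–Wang structure + regular-value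
  theorem for the link): the data of the previous stub ⇒ a compact connected Liouville domain
  `(W, λ)` which is an exact subdomain of `(N ∖ B, s)` (`ι : W ↪ N`, `range ι ∩ B = ∅`,
  `dλ = ι^* s`, `ι` a homotopy equivalence onto `N ∖ B`) and whose boundary is the genus-2 link
  (clause above).
* `stub_complementTopology` (M/L; `ℚ`-Gysin / Mayer–Vietoris / Lefschetz duality — largely provable
  now with the tree's singular homology library): for ANY compact `W` embedded in `N ∖ B` in
  codimension `0` as a homotopy equivalence, `H₂(∂W; ℚ) ↠ H₂(W; ℚ)` (`Q_W ⊗ ℚ ≡ 0`), `b₁(W) = 2`,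
  `b₂(W) = b₃(W) + 2`, `b₃(W) ≤ 2`.
* `stub_smallFillingRigidity` (HARDEST; OPEN — crux-equivalent by capping, transferred): NO compact
  connected Liouville domain `(W, λ)` with that boundary has `H₂(∂W; ℚ) ↠ H₂(W; ℚ)` together with
  `b₁(W) = 2`, `b₂(W) = b₃(W) + 2`, `b₃(W) ≤ 2`.
* `NoGenusTwoDoor_of` (PROVED, pure logic): door ⇒ curve ⇒ filling ⇒ contradiction.

## Disproof.lean honoured (v3, gen 2, read 2026-08-16)

§5 load-bearing hypotheses: `CompactSpace N` is used at `stub_canonicalCurve` (Taubes needs a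
closed manifold) and at `stub_exactComplement` (`W ⊂ N` compact) — the landed negative lemma
`Negative.noGenusTwoDoor_false_without_compact` (imported above; witness `(ℝ² ∖ 0)² ⊂ ℝ⁴`) does
not instantiate any of Stubs 1–3 (all assume `[CompactSpace N]`; see `example` at the end);
closedness and non-degeneracy of `s` are hypotheses of all three `N`-stubs (SW theory and
`dλ = ι^*s` non-degenerate need them; Stub 3 only needs the orientation they induce); `ConnectedSpace N` is carried (Disproof: not load-bearing).  §2/§4/§9 numerics
(`door_numerics`, `filling_numerics`, `complement_bookkeeping`) are exactly the Betti clauses of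
`stub_complementTopology`; `adjunction_no_tori`/`posDef_no_isotropic` explain why `Q_W ≡ 0` is
FORCED (every class of `H₂(W)` is rationally null in `N`).  §10 (NEW, gen 2): exact fillings of the
same contact manifold with `b₁ = 2` EXIST (`W_k`, `χ = k + 2 ≥ 3`, `b⁻ = k + 1 ≥ 2`) — so
`stub_smallFillingRigidity` carries `Q_W ⊗ ℚ ≡ 0` AND `χ(W) = 1` as hypotheses, not `b₁ = 2`
alone, and claims no `b₁ ∈ {0, 4}` dichotomy (dead); Chen 2024's "finite capacity" escape clause is
inhabited by `W₃` (Disproof §10), so the stub is NOT reducible to arXiv:2404.01105 Thm 1 as is.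
No `_false_without_` theorem bites a stub; no stub is an instance of a landed Negative lemma;
`ledger negatives --problem SmoothPoincare4` = 0.
-/

noncomputable section

-- the prescribed namespace `Summit.<P>.<Sub>.…` duplicates `SmoothPoincare4` (P = Sub)
set_option linter.dupNamespace false

open scoped Manifold ContDiff Topology
open Set
open Literature.Topology.FourManifolds (singularHomologyZ BoundaryData)
open Literature.Geometry.Kaehler (MForm IsSmoothForm IsClosedForm mextDeriv)
open Literature.Geometry.Symplectic (IsLiouvilleDomain)
open Literature.AlgebraicTopology.SingularHomology (singularHomology bettiNumber)

namespace Summit.SmoothPoincare4.SmoothPoincare4.Cruxes.NoGenusTwoDoor.LiouvilleGenusTwoComplement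

/-- Model space `ℝⁿ`. -/
local notation "𝔼" n:arg => EuclideanSpace ℝ (Fin n)

/-- THE MODEL CONTACT 3-MANIFOLD (as a subset of `ℝ⁶ = ℂ³`, `zⱼ = p₂ⱼ + i p₂ⱼ₊₁`): the link
`𝕃 = {x² + y⁵ + z¹⁰ = 0} ∩ S⁵` of the weighted homogeneous (weights `(5,2,1)`, degree `10`) isolated
surface singularity — a principal `S¹`-bundle of Euler number `−1` over the genus-2 curve
`{x² + y⁵ + z¹⁰ = 0} ⊂ ℙ(5,2,1)` (the curve misses both orbifold points; `2g − 2 = 10·(10 − 8)/10`),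
`b₁(𝕃) = 4`; with the complex tangencies `ker (λ₀|_𝕃)` it is the Euler-number-`(−1)` Boothby–Wang
(prequantization) contact manifold over `Σ₂`, `(Y_{2,−1}, ξ_BW)` of the cards (triage F3 / N2). -/
local notation "𝕃" => (setOf fun p : EuclideanSpace ℝ (Fin 6) => ‖p‖ = 1 ∧
    Complex.mk (p 0) (p 1) ^ 2 + Complex.mk (p 2) (p 3) ^ 5 + Complex.mk (p 4) (p 5) ^ 10 = 0)

/-- The standard Liouville 1-form `λ₀ = ½ Σⱼ (xⱼ dyⱼ − yⱼ dxⱼ)` of `ℂ³ = ℝ⁶` (`dλ₀ = ω₀`, Liouville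
field `½ r ∂ᵣ`; `= ¼ (−d|z|² ∘ J)`, the Stein-to-Weinstein form of `(ℂ³, |z|²)`), as an `MForm` on the
model-space manifold `𝓘(ℝ, ℝ⁶)`; its restriction to any link of a weighted homogeneous singularity
is a positive contact form defining the canonical (Milnor fillable) contact structure. -/
local notation "λ₆" => (fun p : EuclideanSpace ℝ (Fin 6) =>
    ContinuousAlternatingMap.ofSubsingleton ℝ (EuclideanSpace ℝ (Fin 6)) ℝ (0 : Fin 1)
      ((1 / 2 : ℝ) • (p 0 • (EuclideanSpace.proj 1 : EuclideanSpace ℝ (Fin 6) →L[ℝ] ℝ)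
        - p 1 • (EuclideanSpace.proj 0 : EuclideanSpace ℝ (Fin 6) →L[ℝ] ℝ)
        + p 2 • (EuclideanSpace.proj 3 : EuclideanSpace ℝ (Fin 6) →L[ℝ] ℝ)
        - p 3 • (EuclideanSpace.proj 2 : EuclideanSpace ℝ (Fin 6) →L[ℝ] ℝ)
        + p 4 • (EuclideanSpace.proj 5 : EuclideanSpace ℝ (Fin 6) →L[ℝ] ℝ)
        - p 5 • (EuclideanSpace.proj 4 : EuclideanSpace ℝ (Fin 6) →L[ℝ] ℝ))) :
    MForm 𝓘(ℝ, EuclideanSpace ℝ (Fin 6)) (EuclideanSpace ℝ (Fin 6)) ℝ 1)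

/-! ## Sanity of the model terms (proved `example`s; not stubs, not obligations) -/

/-- `λ₆` is the form it claims to be: `λ₆(p)(v) = ½ Σⱼ (p₂ⱼ v₂ⱼ₊₁ − p₂ⱼ₊₁ v₂ⱼ)`. -/
example (p v : 𝔼 6) : (λ₆) p ![v] =
    (1 / 2 : ℝ) * (p 0 * v 1 - p 1 * v 0 + p 2 * v 3 - p 3 * v 2 + p 4 * v 5 - p 5 * v 4) := by
  simp [PiLp.proj_apply]

/-- The model is NOT vacuous (a typo in `𝕃` would silently make Stub 2 unprovable and Stub 3
vacuous): the point `(x, y, z) = (0, −a, √a)`, `a = (√5 − 1)/2` — so `a² + a = 1` — lies on the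
genus-2 link: `x² + y⁵ + z¹⁰ = −a⁵ + a⁵ = 0` and `|x|² + |y|² + |z|² = a² + a = 1`. -/
example : ((-((Real.sqrt 5 - 1) / 2)) • EuclideanSpace.single (2 : Fin 6) (1 : ℝ) +
      Real.sqrt ((Real.sqrt 5 - 1) / 2) • EuclideanSpace.single (4 : Fin 6) (1 : ℝ) : 𝔼 6) ∈ 𝕃 := by
  set a : ℝ := (Real.sqrt 5 - 1) / 2 with ha
  have h5 : Real.sqrt 5 ^ 2 = 5 := Real.sq_sqrt (by norm_num)
  have h1 : (1 : ℝ) ≤ Real.sqrt 5 := by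
    have h := Real.sqrt_le_sqrt (show (1 : ℝ) ≤ 5 by norm_num)
    rwa [Real.sqrt_one] at h
  have ha0 : 0 ≤ a := by rw [ha]; linarith
  have hkey : a ^ 2 + a = 1 := by rw [ha]; nlinarith [h5]
  have hc : Real.sqrt a ^ 2 = a := Real.sq_sqrt ha0
  set p : 𝔼 6 := (-a) • EuclideanSpace.single (2 : Fin 6) (1 : ℝ) +
      Real.sqrt a • EuclideanSpace.single (4 : Fin 6) (1 : ℝ) with hp
  have hp0 : p 0 = 0 := by simp [hp]
  have hp1 : p 1 = 0 := by simp [hp]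
  have hp2 : p 2 = -a := by simp [hp]
  have hp3 : p 3 = 0 := by simp [hp]
  have hp4 : p 4 = Real.sqrt a := by simp [hp]
  have hp5 : p 5 = 0 := by simp [hp]
  refine ⟨?_, ?_⟩
  · rw [EuclideanSpace.norm_eq, Real.sqrt_eq_one]
    simp only [Fin.sum_univ_succ, Fin.sum_univ_zero, Real.norm_eq_abs, sq_abs]
    simp [hp0, hp1, hp2, hp3, hp4, hp5]
    nlinarith [hc, hkey]
  · rw [hp0, hp1, hp2, hp3, hp4, hp5]
    have e1 : Complex.mk (-a) 0 = ((-a : ℝ) : ℂ) := rfl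
    have e2 : Complex.mk (Real.sqrt a) 0 = ((Real.sqrt a : ℝ) : ℂ) := rfl
    have e0 : Complex.mk (0 : ℝ) 0 = (0 : ℂ) := rfl
    rw [e0, e1, e2]
    have h10 : ((Real.sqrt a : ℝ) : ℂ) ^ 10 = ((a : ℝ) : ℂ) ^ 5 := by
      rw [show (10 : ℕ) = 2 * 5 from rfl, pow_mul]
      congr 1
      exact_mod_cast hc
    rw [h10]
    push_cast
    ring

/-! ## Registered stubs -/

/-- **Stub 1 — the canonical curve (THEOREM in print; XL formally: Seiberg–Witten / Taubes).**
A door — closed connected symplectic `(N, s)` with `rank H₁(N; ℤ) = 2`, `rank H₂(N; ℤ) = 1` —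
contains a smoothly embedded compact connected surface `B = b(S)` of genus `2` (`rank H₁(S; ℤ) = 4`)
with `s`-symplectic image, whose complement has the same first homology:
`H₁(N ∖ B; ℤ) → H₁(N; ℤ)` is a bijection.
Proof in print: `b⁺ = 1`, `b⁻ = 0`, `K² = 2χ + 3σ = 1`, `K ≡ kh` with `k = ±1`
(Disproof §2 `door_numerics`); the Li–Liu/Kronheimer–Mrowka wall-crossing number of `K` is a multiple
of `⟨a ∪ b ∪ ·, [N]⟩`, `a, b ∈ H¹`, which VANISHES because `b₂ = 1` forces `a ∪ b` torsion
(`DoorCupOneOneVanishes`, proved in the r1-3 triage folder `CupLemma.lean`), so `SW(K) = ±1` in the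
chamber of `s` (Taubes 1994) and Taubes' `SW ⇒ Gr` (b⁺ = 1 version: Li–Liu, IMRN 1999 no. 7, "The
equivalence between SW and Gr in the case where b⁺ = 1") represents
`K` by an embedded symplectic curve `B = ⊔ Bᵢ`; each component has positive area hence `[Bᵢ] = mᵢh + tᵢ`
with `mᵢ ≠ 0`, and disjointness `mᵢmⱼ = 0` makes `B` CONNECTED with `[B] = K`, `B·h = k = ±1`;
adjunction `2g − 2 = B² + K·B = 2` gives genus `2`; Gysin: the meridian of `B` is killed by a class
`x` with `x·B = 1` (`x = ±h`), so `H₁(N ∖ B) ≅ H₁(N)` (onto for a codimension-2 complement).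
Shared with card `semidefinite-filling-door` (`door_has_symplectic_genus_two_surface`, SketchIdeator3)
up to the `H₁` clause.  Uses `CompactSpace N`, `IsClosedForm s`, non-degeneracy (Disproof §5: all
load-bearing). [cite: Taubes1994; Taubes1996; LiLiu1999; LiLiu1995; LiLiu2001] -/
theorem stub_canonicalCurve :
    ∀ (N : Type) [TopologicalSpace N] [T2Space N] [SecondCountableTopology N] [CompactSpace N]
      [ConnectedSpace N] [ChartedSpace (𝔼 4) N] [IsManifold (𝓡 4) ∞ N]
      (s : MForm (𝓡 4) N ℝ 2), IsSmoothForm s → IsClosedForm s →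
      (∀ x (v : TangentSpace (𝓡 4) x), v ≠ 0 → ∃ w, s x ![v, w] ≠ 0) →
      Module.finrank ℤ (singularHomologyZ N 1) = 2 →
      Module.finrank ℤ (singularHomologyZ N 2) = 1 →
      ∃ (S : Type) (_ : TopologicalSpace S) (_ : T2Space S) (_ : CompactSpace S)
        (_ : ConnectedSpace S) (_ : ChartedSpace (𝔼 2) S) (_ : IsManifold (𝓡 2) ∞ S) (b : S → N),
        Module.finrank ℤ (singularHomologyZ S 1) = 4 ∧
        Manifold.IsSmoothEmbedding (𝓡 2) (𝓡 4) ∞ b ∧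
        (∀ y (v : TangentSpace (𝓡 2) y), v ≠ 0 → ∃ w : TangentSpace (𝓡 2) y,
            s (b y) ![mfderiv (𝓡 2) (𝓡 4) b y v, mfderiv (𝓡 2) (𝓡 4) b y w] ≠ 0) ∧
        Function.Bijective (singularHomology.map ℤ ℤ
            (⟨Subtype.val, continuous_subtype_val⟩ : C(↥(Set.range b)ᶜ, N)) 1) := by
  sorry

/-- **Stub 2 — the complement of the canonical curve is an EXACT filling of the genus-2 link
(L; symplectic topology of divisor complements).**
Let `(N, s)` be closed connected symplectic with `rank H₁ = 2`, `rank H₂ = 1`, and `b : S ↪ N` a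
smoothly embedded compact connected genus-2 surface (`rank H₁(S) = 4`) with `s`-symplectic image
`B` and `H₁(N ∖ B; ℤ) → H₁(N; ℤ)` bijective.  Then there is a compact connected Liouville domain
`(W, λ)` (tree `IsLiouvilleDomain`: `λ` smooth, `dλ` non-degenerate, Liouville field outward along
`∂W`) together with
(i) an exact symplectic embedding ONTO A DEFORMATION RETRACT of the complement: `ι : W → N` a
smooth embedding of the manifold with boundary, `range ι ∩ B = ∅`, `dλ = ι^* s`, and `ι` co-restricted
to `N ∖ B` is (the map of) a homotopy equivalence `W ≃ₕ N ∖ B`;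
(ii) a boundary datum `bW` whose carrier embeds smoothly onto the genus-2 link `𝕃 ⊂ ℝ⁶` with
`e^* λ₆ = f · (λ|_∂W)`, `f` nowhere zero (`∂(W, λ)` is contactomorphic to `(𝕃, ker λ₀)`).
Proof in print.  EXACTNESS: `H²(N, N ∖ B) ≅ H⁰(B)` (Thom) maps onto the line `H²(N; ℝ)` because the
Thom class goes to `PD[B] ≠ 0` (the meridian bounds in `N ∖ B`, so some class meets `B` once), so
`H²(N; ℝ) → H²(N ∖ B; ℝ)` is ZERO (`RankOnePullbackVanishes`, SketchIdeator1) and `s|_{N∖B} = dθ₀`;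
moreover `[s] = c·PD[B]` with `c = [s]²/(s·B) > 0` (`B` has positive `s`-area) and `B·B = +1`.
LIOUVILLE STRUCTURE: symplectic neighbourhood theorem for `B` (`ν(B)` = the degree-`(+1)` disc
bundle `E` with the `−(f(ρ²)/K)Θ` normal form, CONCAVE seen from inside), then the DIVISOR-
COMPLEMENT LEMMA — Diogo–Lisi, *Symplectic homology of complements of smooth divisors*, J. Topol. 12
(2019) = arXiv:1804.08014, Lemma 1.2 (READ, pp. 6–7; = Opshtein, *Polarizations* Lemma 2.1; Giroux,
*Remarks on Donaldson's symplectic submanifolds* Prop. 5): if `[B]` is Poincaré dual over `ℚ` to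
`[K s]` for some `K > 0` ("symplectic hyperplane section"), then `s|_{N ∖ B}` is exact and there is a
primitive `λ` on `N ∖ B` with `φ^*λ = −(f(ρ²)/K) Θ` on a punctured symplectic tubular neighbourhood
(the defect class `φ₀^*λ₀ − λ_E = π^*μ + dg`, `μ` a CLOSED 1-form on `B` — cf. triage r1-1:
`H¹(W) → H¹(∂W)` has rank `≤ 2 < 4` — is absorbed by the Hamiltonian-lift symplectomorphism of their
proof), so that `N ∖ B ≅ W̄ ∖ ∂W̄` for a LIOUVILLE DOMAIN `W̄` whose boundary is the `ρ₀`-circle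
bundle `Y` of `E` with contact form `α = −(1/K) Θ|_Y`, "a prequantization bundle associated to
`(B, K s|_B)`"; `W̄ ↪ N ∖ B` is a homotopy equivalence (radial deformation retraction of the
punctured tube).  BOUNDARY MODEL: `(Y = ∂W̄ = −S(ν_B) = S(ν_B^*), ker Θ|_Y)` is THE positive
`S¹`-invariant transverse (Boothby–Wang) contact structure on the Euler-number-`(−1)` circle bundle
over `Σ₂` — unique up to contactomorphism (bundle isomorphism + convexity of the set of connection
forms with positive curvature + Gray) — and so is `(𝕃, ker λ₀)`:
the weight-`(5,2,1)` circle action on `𝕃` is free, preserves `λ₀`, and is positively transverse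
(`λ₀(X) = ½ Σ wⱼ|zⱼ|² > 0`), with quotient the genus-2 curve and Euler number `−10/(5·2·1) = −1`
(as oriented boundary of the resolution = total space of a degree-`(−1)` line bundle over `Σ₂`,
i.e. of `D₋₁(Σ₂)`, exactly like `∂W`); whence the contactomorphism `e` (composed with complex
conjugation of `ℂ³`, which preserves `𝕃` and negates `λ₀`, if the coorientations disagree — this
only flips the sign of `f`).  `𝕃` is a smooth compact 3-dimensional submanifold of `ℝ⁶`
(`∇(x² + y⁵ + z¹⁰) ≠ 0` off `0`; the weighted Euler field is tangent to the cone and transverse to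
`S⁵`), which gives the charted-space structure transported to `bW.carrier`.  Sanity (card's cheapest
falsifier, g = 0 analogue): `(ℂP², line)` gives `W = B⁴`, `∂W = (S³, ξ_std)` = the link of a smooth
point = `∂D₋₁(S²)` ✓ (Diogo–Lisi's own example p. 43: `Y = ℝP³` for a conic, `K = 1`).  Uses
`CompactSpace N` (else `W` is not compact), closedness and non-degeneracy of `s` (`dλ = ι^*s` must be
symplectic). [cite: arXiv:1804.08014, Lemma 1.2; Geiges2008, Thm 2.2.2 (Gray) and §7.2 (Boothby–Wang)] -/
theorem stub_exactComplement :
    ∀ (N : Type) [TopologicalSpace N] [T2Space N] [SecondCountableTopology N] [CompactSpace N]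
      [ConnectedSpace N] [ChartedSpace (𝔼 4) N] [IsManifold (𝓡 4) ∞ N]
      (s : MForm (𝓡 4) N ℝ 2), IsSmoothForm s → IsClosedForm s →
      (∀ x (v : TangentSpace (𝓡 4) x), v ≠ 0 → ∃ w, s x ![v, w] ≠ 0) →
      Module.finrank ℤ (singularHomologyZ N 1) = 2 →
      Module.finrank ℤ (singularHomologyZ N 2) = 1 →
      ∀ (S : Type) [TopologicalSpace S] [T2Space S] [CompactSpace S] [ConnectedSpace S]
        [ChartedSpace (𝔼 2) S] [IsManifold (𝓡 2) ∞ S] (b : S → N),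
        Module.finrank ℤ (singularHomologyZ S 1) = 4 →
        Manifold.IsSmoothEmbedding (𝓡 2) (𝓡 4) ∞ b →
        (∀ y (v : TangentSpace (𝓡 2) y), v ≠ 0 → ∃ w : TangentSpace (𝓡 2) y,
            s (b y) ![mfderiv (𝓡 2) (𝓡 4) b y v, mfderiv (𝓡 2) (𝓡 4) b y w] ≠ 0) →
        Function.Bijective (singularHomology.map ℤ ℤ
            (⟨Subtype.val, continuous_subtype_val⟩ : C(↥(Set.range b)ᶜ, N)) 1) →
        ∃ (W : Type) (_ : TopologicalSpace W) (_ : T2Space W) (_ : SecondCountableTopology W)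
          (_ : CompactSpace W) (_ : ConnectedSpace W) (_ : ChartedSpace (EuclideanHalfSpace 4) W)
          (_ : IsManifold (𝓡∂ 4) ∞ W) (lam : MForm (𝓡∂ 4) W ℝ 1) (ι : W → N)
          (bW : BoundaryData (𝓡∂ 4) W (𝓡 3)),
          IsLiouvilleDomain W lam ∧
          (Manifold.IsSmoothEmbedding (𝓡∂ 4) (𝓡 4) ∞ ι ∧ Disjoint (Set.range ι) (Set.range b) ∧
            mextDeriv lam = MForm.pullback (𝓡∂ 4) ι s ∧
            ∃ h : ContinuousMap.HomotopyEquiv W ↥(Set.range b)ᶜ, ∀ w, (h.toFun w : N) = ι w) ∧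
          (∃ (e : bW.carrier → 𝔼 6) (f : bW.carrier → ℝ),
            Manifold.IsSmoothEmbedding (𝓡 3) 𝓘(ℝ, 𝔼 6) ∞ e ∧ Set.range e = 𝕃 ∧ (∀ z, f z ≠ 0) ∧
            ∀ z (v : TangentSpace (𝓡 3) z),
              (λ₆) (e z) ![mfderiv (𝓡 3) 𝓘(ℝ, 𝔼 6) e z v] =
                f z * lam (bW.incl z) ![mfderiv (𝓡 3) (𝓡∂ 4) bW.incl z v]) := by
  sorry

/-- **Stub 3 — topology of the complement (M/L; pure algebraic topology over `ℚ`, largely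
PROVABLE NOW with the tree's singular-homology library: Poincaré/Lefschetz duality, Gysin, excision,
Mayer–Vietoris).**  In the situation of Stub 2 — `(N, s)` closed connected symplectic (hence
oriented) with `rank H₁ = 2`, `rank H₂ = 1`; `B = b(S)` an embedded genus-2 surface with
`H₁(N ∖ B; ℤ) → H₁(N; ℤ)` bijective — let `W` be ANY compact connected 4-manifold with boundary,
smoothly embedded in `N` (codimension `0`) disjointly from `B` such that the co-restriction
`W → N ∖ B` is a homotopy equivalence, and `bW` any boundary datum of `W`.  Then
`H₂(∂W; ℚ) → H₂(W; ℚ)` is SURJECTIVE (⟺ the rational intersection form `Q_W` vanishes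
identically), `b₁(W; ℚ) = 2`, `b₂(W; ℚ) = b₃(W; ℚ) + 2` (i.e. `χ(W) = 1`) and `b₃(W; ℚ) ≤ 2`.
Proof (Disproof §9 `complement_bookkeeping`, re-derived by all three triagers; no symplectic input
beyond orientability of `N`, which `s ∧ s` provides): `H_*(W) ≅ H_*(N ∖ B)`; bijectivity on `H₁`
gives `b₁(W) = b₁(N) = 2` and (Gysin/Thom: the meridian bounds) a class `x ∈ H₂(N)` with
`x·B = ±1`, so `[B]` is rationally non-zero in the LINE `H₂(N; ℚ)` and every class supported in
`N ∖ B` — being orthogonal to `[B]` — is rationally null in `N`; since `ι` is a codimension-0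
embedding, `Q_W(y, y') = ι_*y ·_N ι_*y' = 0`, i.e. `H₂(W; ℚ) → H₂(W, ∂W; ℚ) ≅ H²(W; ℚ) ≅ H₂(W; ℚ)^∨`
vanishes, and by exactness of the pair sequence `H₂(∂W; ℚ) → H₂(W; ℚ)` is onto.
`χ(W) = χ(N ∖ B) = χ(N) − χ(B) = (2 − 4 + 1) − (2 − 4) = 1` (Mayer–Vietoris with a tube `T ≃ B`,
`T ∖ B ≃` circle bundle, `χ = 0`; `b₃(N) = b₁(N)`, `b₄(N) = 1` by Poincaré duality);
`b₃(W) = b¹(W, ∂W) = b¹_c(N ∖ B) = b¹(N, B) = dim ker (H¹(N; ℚ) → H¹(B; ℚ)) ≤ b₁(N) = 2`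
(`H⁰(N) → H⁰(B)` onto); `b₀(W) = 1`, `b₄(W) = 0`, hence `b₂ = b₃ + 2`.  The symplectic clauses on
`s` and `b` are carried only so that the hypotheses coincide verbatim with Stub 2's (they give the
orientation of `N` and, redundantly, `[B] ≠ 0`). [cite: Hatcher2002, Thm 3.43 (Lefschetz duality), §3.3; Bredon1993, VI.11–12 (Thom/Gysin)] -/
theorem stub_complementTopology :
    ∀ (N : Type) [TopologicalSpace N] [T2Space N] [SecondCountableTopology N] [CompactSpace N]
      [ConnectedSpace N] [ChartedSpace (𝔼 4) N] [IsManifold (𝓡 4) ∞ N]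
      (s : MForm (𝓡 4) N ℝ 2), IsSmoothForm s → IsClosedForm s →
      (∀ x (v : TangentSpace (𝓡 4) x), v ≠ 0 → ∃ w, s x ![v, w] ≠ 0) →
      Module.finrank ℤ (singularHomologyZ N 1) = 2 →
      Module.finrank ℤ (singularHomologyZ N 2) = 1 →
      ∀ (S : Type) [TopologicalSpace S] [T2Space S] [CompactSpace S] [ConnectedSpace S]
        [ChartedSpace (𝔼 2) S] [IsManifold (𝓡 2) ∞ S] (b : S → N),
        Module.finrank ℤ (singularHomologyZ S 1) = 4 →
        Manifold.IsSmoothEmbedding (𝓡 2) (𝓡 4) ∞ b →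
        (∀ y (v : TangentSpace (𝓡 2) y), v ≠ 0 → ∃ w : TangentSpace (𝓡 2) y,
            s (b y) ![mfderiv (𝓡 2) (𝓡 4) b y v, mfderiv (𝓡 2) (𝓡 4) b y w] ≠ 0) →
        Function.Bijective (singularHomology.map ℤ ℤ
            (⟨Subtype.val, continuous_subtype_val⟩ : C(↥(Set.range b)ᶜ, N)) 1) →
        ∀ (W : Type) [TopologicalSpace W] [T2Space W] [SecondCountableTopology W] [CompactSpace W]
          [ConnectedSpace W] [ChartedSpace (EuclideanHalfSpace 4) W] [IsManifold (𝓡∂ 4) ∞ W]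
          (ι : W → N) (bW : BoundaryData (𝓡∂ 4) W (𝓡 3)),
          Manifold.IsSmoothEmbedding (𝓡∂ 4) (𝓡 4) ∞ ι → Disjoint (Set.range ι) (Set.range b) →
          (∃ h : ContinuousMap.HomotopyEquiv W ↥(Set.range b)ᶜ, ∀ w, (h.toFun w : N) = ι w) →
          Function.Surjective (singularHomology.map ℚ ℚ
            (⟨bW.incl, bW.continuous_incl⟩ : C(bW.carrier, W)) 2) ∧
          bettiNumber ℚ W 1 = 2 ∧ bettiNumber ℚ W 2 = bettiNumber ℚ W 3 + 2 ∧
            bettiNumber ℚ W 3 ≤ 2 := by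
  sorry

/-- **Stub 4 — SMALL-FILLING RIGIDITY of the genus-2 link (HARDEST; OPEN: the crux transferred,
zero slack).**  No compact connected Liouville domain `(W, λ)` whose boundary is contactomorphic to
the genus-2 link `(𝕃, ker λ₀)` (clause (ii) of Stub 2) and whose rational intersection form
vanishes identically (`H₂(∂W; ℚ) ↠ H₂(W; ℚ)`) has `b₁(W) = 2`, `b₂(W) = b₃(W) + 2` (`χ(W) = 1`)
and `b₃(W) ≤ 2`.
WHY IT IS THE CRUX (converse, in print): glue the concave cap `D₊₁(Σ₂)` to such a `W`; the closed
symplectic `X` has `H₂(X; ℚ) = im H₂(W) + ℚ[Σ₂]` with the first summand isotropic and orthogonal to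
`[Σ₂]`, hence zero, so `b₂(X) = 1` with a symplectic genus-2 class of square `1`; `2 = m(m + k)`,
`k` odd, `k² = K² = 2χ + 3σ` force `χ(X) = −1`, `b₁(X) = 2`: `X` is a door (triage
`GenusTwoPinsDoor`; Disproof §4 `filling_numerics`).  WHY IT IS EASIER HERE (the Transfer's stated
gain, triage-accepted): (1) the boundary is ONE explicit Seifert contact manifold with periodic Reeb
flow (every orbit a fibre over `Σ₂`), `c₁(ξ) = 0`, integrable Morse–Bott SFT/ECH data computable
from `Σ₂` (Nelson–Weiler), instead of "a closed manifold nobody has seen"; (2) explicit EXACT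
comparison fillings share the door's cap: `D₋₁(Σ₂)`_Stein `(b₁; χ, b⁻) = (4; −2, 1)`
(Bogomolov–de Oliveira), the disprover's `W_k` `(2; k + 2, k + 1)_{k ≥ 1}` (Dorfmeister–Li relative
cone, Disproof §10), rational `(0; k + 5, k + 4)`, Godeaux `(0; 13, 8)`, the Milnor fibre of
`x² + y⁵ + z¹⁰` `(0; 37, 28)` — the forbidden filling is the single lattice point `(2; 1, 0)`, the
`k = −1` extrapolation of the `W_k` line `b⁻ = χ − 1`, so every neck-stretching / cobordism-map
statement about it can be calibrated on honest neighbours; (3) it is the first cell of an active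
classification programme (fillings of `S¹`-invariant contact manifolds: Ohta–Ono `g = 1`;
McDuff / Li–Mak–Yasui `e ≥ 2g − 2`; Lisi–Van Horn-Morris–Wendl spinal open books with `Γ ≠ ∅`;
here `(g, e) = (2, −1)`, `K_cap·B = 1`: the first general-type cap).  LOAD-BEARING HYPOTHESES (do
not drop): `Q_W ⊗ ℚ ≡ 0` AND `χ = 1` — the `W_k` have `b₁ = 2` but `b⁻ ≥ 2`, `χ ≥ 3`; `D₋₁(Σ₂)`
has `χ = −2`; the `b₁ = 0` fillings void every `H₁`-action obstruction (triage F3) and `W₃` inhabits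
Chen's infinite-capacity clause (Disproof §10), so neither arXiv:2404.01105 Thm 1 nor plane counts
alone (the Milnor fibre is plane-free too, triage N2) can close it; Liouville (exact), not Stein:
the complement is Weinstein only if `b₃ = 0` (`r = 2`), Bowden-type exact-non-Stein fillings are
expected (card `weinstein-door-presentation` = the `b₃ = 0` sub-case + the negative-side Legendrian
search).  Sub-cases by `b₃(W) = 2 − r ∈ {0, 1, 2}` (`r = rank (H₁(∂W; ℚ) → H₁(W; ℚ))`) are the
natural first reshape. [cite: arXiv:2404.01105, Thm 1; arXiv:1810.12017; doi:10.4310/jsg.2023.v21.n6.a1; doi:10.1093/imrn/rny166; doi:10.1112/plms.12007; doi:10.1007/s002220050183, Thm 1.1–1.2] -/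
theorem stub_smallFillingRigidity :
    ∀ (W : Type) [TopologicalSpace W] [T2Space W] [SecondCountableTopology W] [CompactSpace W]
      [ConnectedSpace W] [ChartedSpace (EuclideanHalfSpace 4) W] [IsManifold (𝓡∂ 4) ∞ W]
      (lam : MForm (𝓡∂ 4) W ℝ 1) (bW : BoundaryData (𝓡∂ 4) W (𝓡 3)),
      IsLiouvilleDomain W lam →
      (∃ (e : bW.carrier → 𝔼 6) (f : bW.carrier → ℝ),
        Manifold.IsSmoothEmbedding (𝓡 3) 𝓘(ℝ, 𝔼 6) ∞ e ∧ Set.range e = 𝕃 ∧ (∀ z, f z ≠ 0) ∧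
        ∀ z (v : TangentSpace (𝓡 3) z),
          (λ₆) (e z) ![mfderiv (𝓡 3) 𝓘(ℝ, 𝔼 6) e z v] =
            f z * lam (bW.incl z) ![mfderiv (𝓡 3) (𝓡∂ 4) bW.incl z v]) →
      Function.Surjective (singularHomology.map ℚ ℚ
        (⟨bW.incl, bW.continuous_incl⟩ : C(bW.carrier, W)) 2) →
      ¬ (bettiNumber ℚ W 1 = 2 ∧ bettiNumber ℚ W 2 = bettiNumber ℚ W 3 + 2 ∧
          bettiNumber ℚ W 3 ≤ 2) := by
  sorry

/-! ## Composition (kernel-checked; `sorryAx` enters only through the four stubs) -/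

/-- **The line closes the crux.**  A door `(N, s)` has a canonical genus-2 curve `B` with
`H₁(N ∖ B) ≅ H₁(N)` (Stub 1); its exact complement is a Liouville filling `(W, λ)` of the genus-2
link, embedded in `N ∖ B` as a homotopy equivalence (Stub 2), hence with `Q_W ⊗ ℚ ≡ 0`, `b₁ = 2`,
`b₂ = b₃ + 2`, `b₃ ≤ 2` (Stub 3); no such filling exists (Stub 4).  Pure logic; concludes the route
decl `SymplecticOrigami.NoGenusTwoDoor` BY NAME with no hypotheses. -/
theorem NoGenusTwoDoor_of :
    Summit.SmoothPoincare4.SmoothPoincare4.Theses.SymplecticOrigami.NoGenusTwoDoor := by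
  intro N _ _ _ _ _ _ _ s hs hc hnd hdoor
  obtain ⟨hb1, hb2⟩ := hdoor
  -- Stub 1: the canonical genus-2 curve `B = b(S)` with `H₁(N ∖ B) ≅ H₁(N)`
  obtain ⟨S, _, _, _, _, _, _, b, hS, hb, hbs, hH1⟩ := stub_canonicalCurve N s hs hc hnd hb1 hb2
  -- Stub 2: its exact complement, a Liouville filling of the genus-2 link
  obtain ⟨W, _, _, _, _, _, _, _, lam, ι, bW, hL, ⟨hι, hdisj, _hexact, hhe⟩, hbdry⟩ :=
    stub_exactComplement N s hs hc hnd hb1 hb2 S b hS hb hbs hH1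
  -- Stub 3: the complement's forced topology
  obtain ⟨hQ, hW1, hW2, hW3⟩ :=
    stub_complementTopology N s hs hc hnd hb1 hb2 S b hS hb hbs hH1 W ι bW hι hdisj hhe
  -- Stub 4: no such filling
  exact stub_smallFillingRigidity W lam bW hL hbdry hQ ⟨hW1, hW2, hW3⟩

/-- The landed negative lemma of the crux (Disproof §5, p74187: the crux WITHOUT `[CompactSpace N]`
is false, witness `(ℝ² ∖ 0)² ⊂ ℝ⁴`) is in scope and does not instantiate Stubs 1–3, all of
which quantify over COMPACT `N` only. -/
example : ¬ ∀ (N : Type) [TopologicalSpace N] [T2Space N] [SecondCountableTopology N]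
    [ConnectedSpace N] [ChartedSpace (EuclideanSpace ℝ (Fin 4)) N] [IsManifold (𝓡 4) ∞ N]
    (s : MForm (𝓡 4) N ℝ 2), IsSmoothForm s → IsClosedForm s →
    (∀ x (v : TangentSpace (𝓡 4) x), v ≠ 0 → ∃ w, s x ![v, w] ≠ 0) →
    ¬ (Module.finrank ℤ (singularHomologyZ N 1) = 2 ∧
        Module.finrank ℤ (singularHomologyZ N 2) = 1) :=
  Summit.SmoothPoincare4.SmoothPoincare4.Theorems.NoGenusTwoDoor.Negative.noGenusTwoDoor_false_without_compact

end Summit.SmoothPoincare4.SmoothPoincare4.Cruxes.NoGenusTwoDoor.LiouvilleGenusTwoComplement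

end
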